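import Summits.ABC.StewartYu.PadicShapeOneSubOdd
import Summits.ABC.StewartYu.PadicShapeOneSubTwo
import HarnessLib

/-!
# Cell abc-stewartyu — draft route `YuMatveevShapeRat` (plan-m3 g2, HOME/plan-m3/next/SketchGA.lean):
# the support item `PadicShapeChain : PadicCoreOddRat → PadicCoreTwoRat → PadicHalf`, PROVED

Cell `abc-stewartyu` (HOME `run/shared/lean/pub/abc-stewartyu/`; seat `lit-abc-yu2007` g3). Theorems only;
no definition, no named fact, nothing closed (the route is a draft, not opened). `padicHalf_of_padicCores`
is the planner's `PadicShapeChain` with the three definitions unfolded, texts verbatim: from the two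
Kummer-free `p`-adic SHAPE cores over `ℚ` (odd `p`: independent rational `p`-adic units; `p = 2`: independent
rationals `≡ 1 (mod 8)`) to the `p`-adic half of the library rung "A1.L" (`∃ K ≥ 1`: for `ξᵢ ∈ ℚ ∖ {0, ±1}`,
`ζ = ±1`, `Ξ = ζ∏ξᵢ^{bᵢ} ≠ 1`, every prime `p`:
`ord_p(1 − Ξ) log p < K^{#ι} (p/log p) log max(e, p h(Ξ)) ∏ h(ξᵢ)`). Chain: dependence removal
(`padicShape_dep_of_indep_odd/two`) → non-units, torsion, `mod 8` (`padicShape_oneSub_of_indep_odd/two`)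
→ HERE, Evertse–Győry §4.4.2 at a finite place with `α = 1`: Case B `h(Ξ) ≤ Θ = ∏h(ξᵢ)`: the Liouville
estimate `ord_p(1 − Ξ) log p ≤ h(1 − Ξ) ≤ log 2 + h(Ξ)` suffices; Case A `Θ < h(Ξ)`: small exponents
(`exists_small_exponents`, Prop. 4.4.1: `Ξ = ζ'∏ξ'ᵢ^{b'ᵢ}`, `∏h(ξ'ᵢ) ≤ Θ`, `|b'ᵢ| ≤ m^{2m}h(Ξ)/log 2`),
`Aᵢ = h(ξ'ᵢ)/log 2`, `A_max = Θ/(log 2)^m` (so `log 2A_max ≤ 0.7 + 0.37m + log h(Ξ)` — this is where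
Case A is used), `W = log max(3, m^{2m}h(Ξ)/log 2)`, and `W + log p + log 2A_max ≤ 9^m log max(e, p h(Ξ))`;
`K = 9 max(|c₁|,|c₂|,1)/log 2 + 4`. WHAT THIS IS NOT: the cruxes `PadicCoreOddRat`/`PadicCoreTwoRat`
(Kummer-free Gen-3 engines with constant `cⁿ`) are NOT proved; no route item is closed; no abc claim.
References: [EvertseGyory2015] Prop. 4.4.1, §4.4.2 (pp. 80–81); [Yu2007]; [Matveev2000] §21.
-/

open Height Real Finset
open Literature.NumberTheory.DiophantineGeometry.Dioph

noncomputable section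

namespace Summit.ABC.StewartYu

namespace PadicShapeChainProof

/-- `2m² + m + 6 ≤ 9^m` for `m ≥ 1`. [folklore] -/
private theorem numeric_le_nine_pow (m : ℕ) (hm : 1 ≤ m) :
    2 * (m : ℝ) ^ 2 + m + 6 ≤ (9 : ℝ) ^ m := by
  have key : ∀ n : ℕ, 2 * (n + 1) ^ 2 + (n + 1) + 6 ≤ 9 ^ (n + 1) := by
    intro n
    induction n with
    | zero => norm_num
    | succ k ih =>
      have : 2 * (k + 1 + 1) ^ 2 + (k + 1 + 1) + 6 ≤ 9 * (2 * (k + 1) ^ 2 + (k + 1) + 6) := by nlinarith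
      calc 2 * (k + 1 + 1) ^ 2 + (k + 1 + 1) + 6 ≤ 9 * (2 * (k + 1) ^ 2 + (k + 1) + 6) := this
        _ ≤ 9 * 9 ^ (k + 1) := Nat.mul_le_mul_left 9 ih
        _ = 9 ^ (k + 1 + 1) := by ring
  obtain ⟨n, rfl⟩ : ∃ n, m = n + 1 := ⟨m - 1, by omega⟩
  have := key n
  exact_mod_cast this

/-- `log(log 2) ≥ −0.4`, i.e. `−log(log 2) ≤ 0.4`. [folklore] -/
private theorem neg_log_log_two_le : -Real.log (Real.log 2) ≤ 0.4 := by
  have h3 := Real.log_two_gt_d9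
  have hq := Real.quadratic_le_exp_of_nonneg (show (0 : ℝ) ≤ 0.4 by norm_num)
  have h1 : Real.exp (-0.4) ≤ Real.log 2 := by
    rw [Real.exp_neg, inv_le_comm₀ (Real.exp_pos _) (Real.log_pos one_lt_two),
      inv_le_iff_one_le_mul₀ (Real.log_pos one_lt_two)]
    nlinarith
  have := Real.log_le_log (Real.exp_pos _) h1
  rw [Real.log_exp] at this
  linarith

end PadicShapeChainProof

set_option maxHeartbeats 800000 in
open PadicShapeChainProof in
/-- **`PadicShapeChain` of the draft route `YuMatveevShapeRat`, proved**: the planner's texts of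
`PadicCoreOddRat` and `PadicCoreTwoRat` imply the planner's `PadicHalf` text (all verbatim, definitions
unfolded). Evertse–Győry §4.4.2 at the finite places with `α = 1` (Case A/B on `h(Ξ)` versus `∏h(ξᵢ)`) on top
of `padicShape_oneSub_of_indep_odd/two` and `exists_small_exponents`.
[cite: EvertseGyory2015, Prop 4.4.1 and §4.4.2 (pp. 80–81)] -/
theorem padicHalf_of_padicCores
    (hodd : ∃ c : ℝ, ∀ (p : ℕ), p.Prime → p ≠ 2 →
      ∀ (r : ℕ) (θ : Fin r → ℚ) (m : Fin r → ℤ) (A : Fin r → ℝ) (Amax W : ℝ),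
        (∀ i, θ i ≠ 0 ∧ padicValRat p (θ i) = 0) →
        (∀ μ : Fin r → ℤ, ∏ i, θ i ^ μ i = 1 → μ = 0) →
        (∀ i, Height.logHeight₁ (θ i) ≤ A i) → (∀ i, 1 ≤ A i) → (∀ i, A i ≤ Amax) →
        m ≠ 0 → (∀ i, Real.log (max 3 (|m i| : ℝ)) ≤ W) → 1 ≤ W →
        (padicValRat p (∏ i, θ i ^ m i - 1) : ℝ) * Real.log p ≤
          c ^ r * ((p : ℝ) / Real.log p) * (∏ i, A i) * (W + Real.log p + Real.log (2 * Amax)))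
    (htwo : ∃ c : ℝ, ∀ (r : ℕ) (θ : Fin r → ℚ) (m : Fin r → ℤ) (A : Fin r → ℝ) (Amax W : ℝ),
      (∀ i, 3 ≤ padicValRat 2 (θ i - 1)) →
      (∀ μ : Fin r → ℤ, ∏ i, θ i ^ μ i = 1 → μ = 0) →
      (∀ i, Height.logHeight₁ (θ i) ≤ A i) → (∀ i, 1 ≤ A i) → (∀ i, A i ≤ Amax) →
      m ≠ 0 → (∀ i, Real.log (max 3 (|m i| : ℝ)) ≤ W) → 1 ≤ W →
      (padicValRat 2 (∏ i, θ i ^ m i - 1) : ℝ) ≤ c ^ r * (∏ i, A i) * (W + Real.log (2 * Amax))) :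
    ∃ K : ℝ, 1 ≤ K ∧ ∀ (ι : Type) [Fintype ι], 0 < Fintype.card ι → ∀ ξ : ι → ℚ,
      (∀ i, ξ i ≠ 0 ∧ ξ i ≠ 1 ∧ ξ i ≠ -1) → ∀ ζ : ℚ, (ζ = 1 ∨ ζ = -1) → ∀ b : ι → ℤ,
      ζ * ∏ i, ξ i ^ b i ≠ 1 → ∀ p : ℕ, p.Prime →
        (padicValRat p (1 - ζ * ∏ i, ξ i ^ b i) : ℝ) * Real.log p <
          K ^ Fintype.card ι * (p / Real.log p) *
            Real.log (max (Real.exp 1) (p * Height.logHeight₁ (ζ * ∏ i, ξ i ^ b i))) *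
            ∏ i, Height.logHeight₁ (ξ i) := by
  obtain ⟨c₁, hc₁⟩ := padicShape_oneSub_of_indep_odd hodd
  obtain ⟨c₂, hc₂⟩ := padicShape_oneSub_of_indep_two htwo
  set c₀ := max (max |c₁| |c₂|) 1 with hc₀
  have hc₀1 : 1 ≤ c₀ := le_max_right _ _
  have hc₀₁ : |c₁| ≤ c₀ := (le_max_left _ _).trans (le_max_left _ _)
  have hc₀₂ : |c₂| ≤ c₀ := (le_max_right _ _).trans (le_max_left _ _)
  have hlog2 : 0 < Real.log 2 := Real.log_pos one_lt_two
  have hl2 : Real.log 2 < 1 := by have := Real.log_two_lt_d9; linarith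
  have hl2' : (0.69 : ℝ) < Real.log 2 := by have := Real.log_two_gt_d9; linarith
  have hll2 := neg_log_log_two_le
  set K₀ := 9 * c₀ / Real.log 2 with hK₀
  have hK₀1 : 9 ≤ K₀ := by rw [hK₀, le_div_iff₀ hlog2]; linarith only [hl2, hc₀1]
  refine ⟨K₀ + 4, by linarith, ?_⟩
  intro ι _ hι ξ hξ ζ hζ b hΞ1 p hp
  classical
  haveI : Fact p.Prime := ⟨hp⟩
  set m := Fintype.card ι with hm
  have hm1 : 1 ≤ m := hι
  set Ξ : ℚ := ζ * ∏ i, ξ i ^ b i with hΞ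
  set Θ := ∏ i, logHeight₁ (ξ i) with hΘ
  set M := max (Real.exp 1) ((p : ℝ) * logHeight₁ Ξ) with hM
  set Y := Real.log M with hY
  set q := (p : ℝ) / Real.log p with hq
  set K := K₀ + 4 with hK
  have hE := Real.exp_pos 1
  have he1 := Real.exp_one_gt_d9
  have hp1 : (1 : ℝ) < p := by exact_mod_cast hp.one_lt
  have hp2 : (2 : ℝ) ≤ p := by exact_mod_cast hp.two_le
  have hlogp : 0 < Real.log p := Real.log_pos hp1
  have hq1 : 1 ≤ q := by
    rw [hq, le_div_iff₀ hlogp]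
    have := Real.log_le_sub_one_of_pos (show (0 : ℝ) < p by linarith); linarith
  have hMe : Real.exp 1 ≤ M := le_max_left _ _
  have hM0 : 0 < M := lt_of_lt_of_le hE hMe
  have hY1 : 1 ≤ Y := by rw [hY, ← Real.log_exp 1]; exact Real.log_le_log hE hMe
  have hhξ : ∀ i, Real.log 2 ≤ logHeight₁ (ξ i) := fun i =>
    log_two_le_logHeight₁ (hξ i).1 (hξ i).2.1 (hξ i).2.2
  have hΘlow : Real.log 2 ^ m ≤ Θ := by
    have : ∏ _i : ι, Real.log 2 ≤ ∏ i, logHeight₁ (ξ i) :=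
      Finset.prod_le_prod (fun _ _ => hlog2.le) fun i _ => hhξ i
    rwa [Finset.prod_const, card_univ, ← hm] at this
  have hl2m : 0 < Real.log 2 ^ m := pow_pos hlog2 m
  have hΘpos : 0 < Θ := lt_of_lt_of_le hl2m hΘlow
  have hK9 : 9 ≤ K := by linarith
  have hKm : K ≤ K ^ m := by
    calc K = K ^ 1 := (pow_one K).symm
      _ ≤ K ^ m := pow_le_pow_right₀ (by linarith) hm1
  -- the right-hand side dominates `log 2 + Θ` (Case B) — `(K^m − 1) Θ ≥ (K − 1)(log 2)^m ≥ …` is too weak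
  -- for large `m`; use instead `K^m Θ ≥ K^m (log 2)^m = (K log 2)^m ≥ K log 2 ≥ 6 > log 2 + …`? No: `Θ` may
  -- be large. Split `K^m Θ = Θ + (K^m − 1)Θ ≥ Θ + (K^m − 1)(log 2)^m` and `(K^m − 1)(log 2)^m ≥ (K log 2)^m / 2`.
  have hRHSbig : Real.log 2 + Θ < K ^ m * q * Y * Θ := by
    have hKl : 9 * 0.69 ≤ K * Real.log 2 := mul_le_mul hK9 hl2'.le (by norm_num) (by linarith only [hK9])
    have h1 : K * Real.log 2 ≤ (K * Real.log 2) ^ m := by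
      calc K * Real.log 2 = (K * Real.log 2) ^ 1 := (pow_one _).symm
        _ ≤ (K * Real.log 2) ^ m := pow_le_pow_right₀ (by linarith only [hKl]) hm1
    have h2 : (K * Real.log 2) ^ m = K ^ m * Real.log 2 ^ m := mul_pow _ _ _
    have h4 : (2 : ℝ) ≤ K ^ m := by linarith only [hKm, hK9]
    -- `K^m Θ ≥ Θ + (K^m − 1)(log 2)^m ≥ Θ + (K^m/2)(log 2)^m ≥ Θ + 3 > Θ + log 2`
    have h5 : K ^ m / 2 * Real.log 2 ^ m ≤ (K ^ m - 1) * Real.log 2 ^ m :=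
      mul_le_mul_of_nonneg_right (by linarith only [h4]) hl2m.le
    have h6 : (K ^ m - 1) * Real.log 2 ^ m ≤ (K ^ m - 1) * Θ :=
      mul_le_mul_of_nonneg_left hΘlow (by linarith only [h4])
    have hKΘ : 0 ≤ K ^ m * Θ := by positivity
    have h7 : K ^ m * Θ * 1 * 1 ≤ K ^ m * Θ * q * Y :=
      mul_le_mul (mul_le_mul_of_nonneg_left hq1 hKΘ) hY1 zero_le_one (by positivity)
    linarith only [hKl, h1, h2, h5, h6, h7, hl2]
  -- Liouville: `ord_p(1 − Ξ) log p ≤ log 2 + h(Ξ)`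
  have hΞ1' : (1 : ℚ) - Ξ ≠ 0 := sub_ne_zero.mpr (Ne.symm hΞ1)
  have hLiou : (padicValRat p (1 - Ξ) : ℝ) * Real.log p ≤ Real.log 2 + logHeight₁ Ξ :=
    (padicValRat_mul_log_le_logHeight₁ p hp hΞ1').trans (logHeight₁_one_sub_le Ξ)
  -- Case B: `h(Ξ) ≤ Θ`
  by_cases hcase : logHeight₁ Ξ ≤ Θ
  · linarith only [hLiou, hcase, hRHSbig]
  push Not at hcase
  -- Case A: `Θ < h(Ξ)`; in particular `h(Ξ) > 0`, `log Θ < log h(Ξ) ≤ Y`, `log p ≤ Y + 0.37`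
  have hh0 : 0 < logHeight₁ Ξ := hΘpos.trans hcase
  have hΞ0 : Ξ ≠ 0 := by
    rw [hΞ]; exact mul_ne_zero (by rcases hζ with h | h <;> simp [h])
      (Finset.prod_ne_zero_iff.mpr fun i _ => zpow_ne_zero _ (hξ i).1)
  have hΞm1 : Ξ ≠ -1 := by
    intro h; rw [h, logHeight₁_neg, logHeight₁_one] at hh0; exact lt_irrefl _ hh0
  have hhΞ2 : Real.log 2 ≤ logHeight₁ Ξ := log_two_le_logHeight₁ hΞ0 hΞ1 hΞm1
  have hlogh : Real.log (logHeight₁ Ξ) ≤ Y - Real.log p := by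
    have h1 : Real.log ((p : ℝ) * logHeight₁ Ξ) ≤ Y := Real.log_le_log (by positivity) (le_max_right _ _)
    rw [Real.log_mul (by positivity) hh0.ne'] at h1
    linarith only [h1]
  have hlogp_le : Real.log p ≤ Y + 0.4 := by
    have h1 := Real.log_le_log hlog2 hhΞ2
    linarith only [h1, hlogh, hll2]
  have hlogΘ : Real.log Θ ≤ Y := by
    have := Real.log_lt_log hΘpos hcase; linarith only [this, hlogh, hlogp]
  -- small exponents (Prop. 4.4.1) and transport to `Fin m`
  obtain ⟨ξ', ζ', b', hξ', hζ', hΞeq, hprodh, hb'⟩ := exists_small_exponents hι ξ hξ ζ hζ b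
  have hhξ' : ∀ i, Real.log 2 ≤ logHeight₁ (ξ' i) := fun i =>
    log_two_le_logHeight₁ (hξ' i).1 (hξ' i).2.1 (hξ' i).2.2
  set e : ι ≃ Fin m := Fintype.equivFin ι with he
  set ξf : Fin m → ℚ := fun j => ξ' (e.symm j) with hξf
  set bf : Fin m → ℤ := fun j => b' (e.symm j) with hbf
  set Af : Fin m → ℝ := fun j => logHeight₁ (ξf j) / Real.log 2 with hAf
  set X := (m : ℝ) ^ (2 * m) * logHeight₁ Ξ / Real.log 2 with hX
  set W := Real.log (max 3 X) with hW
  set Amax := Θ / Real.log 2 ^ m with hAmax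
  have hprodf : ζ' * ∏ j, ξf j ^ bf j = Ξ := by
    rw [hΞ, hΞeq]
    congr 1
    exact Fintype.prod_equiv e.symm (fun j => ξf j ^ bf j) (fun i => ξ' i ^ b' i) fun j => rfl
  have hAf1 : ∀ j, 1 ≤ Af j := fun j => by
    rw [hAf]; dsimp only; rw [le_div_iff₀ hlog2, one_mul]; exact hhξ' _
  have hAfh : ∀ j, logHeight₁ (ξf j) ≤ Af j := fun j => by
    rw [hAf]; dsimp only; rw [le_div_iff₀ hlog2]; nlinarith [Height.zero_le_logHeight₁ (ξf j)]
  have hAprod : ∏ j, Af j = (∏ i, logHeight₁ (ξ' i)) / Real.log 2 ^ m := by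
    rw [hAf]; dsimp only
    rw [Finset.prod_div_distrib, Finset.prod_const, card_univ, Fintype.card_fin]
    congr 1
    exact Fintype.prod_equiv e.symm (fun j => logHeight₁ (ξf j)) (fun i => logHeight₁ (ξ' i)) fun j => rfl
  have hAle : ∏ j, Af j ≤ Amax := by
    rw [hAprod, hAmax]; exact div_le_div_of_nonneg_right hprodh hl2m.le
  have hA0 : 0 ≤ ∏ j, Af j := Finset.prod_nonneg fun j _ => (zero_le_one.trans (hAf1 j))
  have hAfmax : ∀ j, Af j ≤ Amax := by
    intro j
    refine le_trans ?_ hAle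
    rw [← Finset.mul_prod_erase univ Af (mem_univ j)]
    have h1 : 1 ≤ ∏ k ∈ univ.erase j, Af k := by
      rw [← Finset.prod_const_one (s := univ.erase j)]
      exact Finset.prod_le_prod (fun _ _ => zero_le_one) fun k _ => hAf1 k
    have h0 : 0 ≤ Af j := zero_le_one.trans (hAf1 j)
    exact le_mul_of_one_le_right h0 h1
  have hAmax1 : 1 ≤ Amax := (hAf1 ⟨0, hm1⟩).trans (hAfmax ⟨0, hm1⟩)
  have hX0 : 0 ≤ X := by rw [hX]; positivity
  have h3X : (0 : ℝ) < max 3 X := lt_of_lt_of_le (by norm_num) (le_max_left _ _)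
  have hbW : ∀ j, Real.log (max 3 (|bf j| : ℝ)) ≤ W := by
    intro j
    have h1 : (|bf j| : ℝ) ≤ X := hb' (e.symm j)
    exact Real.log_le_log (lt_of_lt_of_le (by norm_num) (le_max_left _ _)) (max_le_max le_rfl h1)
  have hW1 : 1 ≤ W := by
    rw [hW]
    have h1 : Real.log 3 ≥ 1 := by
      rw [ge_iff_le, ← Real.log_exp 1]
      exact Real.log_le_log hE (by have := Real.exp_one_lt_d9; linarith)
    linarith [Real.log_le_log (by norm_num : (0 : ℝ) < 3) (le_max_left 3 X)]
  -- the bound from the `oneSub` lemmas, uniformly in `p`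
  have hG2 : 0 ≤ W + Real.log (2 * Amax) := by
    have := Real.log_nonneg (show (1 : ℝ) ≤ 2 * Amax by linarith only [hAmax1]); linarith only [this, hW1]
  have hG0 : 0 ≤ W + Real.log p + Real.log (2 * Amax) := by linarith only [hG2, hlogp]
  have hmain : (padicValRat p (1 - Ξ) : ℝ) * Real.log p ≤
      c₀ ^ m * q * (∏ j, Af j) * (W + Real.log p + Real.log (2 * Amax)) := by
    have hR0 : 0 ≤ c₀ ^ m * q * (∏ j, Af j) * (W + Real.log p + Real.log (2 * Amax)) := by positivity
    by_cases hv : (0 : ℝ) ≤ (padicValRat p (1 - Ξ) : ℝ)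
    swap
    · push Not at hv
      have : (padicValRat p (1 - Ξ) : ℝ) * Real.log p ≤ 0 :=
        mul_nonpos_of_nonpos_of_nonneg hv.le hlogp.le
      linarith only [this, hR0]
    have hq2 : c₀ ^ m * 1 * (∏ j, Af j) ≤ c₀ ^ m * q * (∏ j, Af j) :=
      mul_le_mul_of_nonneg_right (mul_le_mul_of_nonneg_left hq1 (by positivity)) hA0
    by_cases hp2 : p = 2
    · subst hp2
      have h := hc₂ m ξf bf Af Amax W ζ' hζ' (fun j => (hξ' _).1) hAfh hAf1 hAfmax hAmax1 hbW hW1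
        (by rw [hprodf]; exact hΞ1)
      rw [hprodf] at h
      have hcm : c₂ ^ m ≤ c₀ ^ m :=
        le_trans (by rw [← abs_pow]; exact le_abs_self _) (pow_le_pow_left₀ (abs_nonneg _) hc₀₂ m)
      have hlog2' : Real.log ((2 : ℕ) : ℝ) = Real.log 2 := by norm_num
      have h1 : (padicValRat 2 (1 - Ξ) : ℝ) * Real.log ((2 : ℕ) : ℝ) ≤ (padicValRat 2 (1 - Ξ) : ℝ) := by
        rw [hlog2']
        have := mul_le_mul_of_nonneg_left hl2.le hv
        linarith only [this]
      have h2 : c₂ ^ m * (∏ j, Af j) * (W + Real.log (2 * Amax)) ≤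
          c₀ ^ m * q * (∏ j, Af j) * (W + Real.log ((2 : ℕ) : ℝ) + Real.log (2 * Amax)) := by
        calc c₂ ^ m * (∏ j, Af j) * (W + Real.log (2 * Amax))
            ≤ c₀ ^ m * 1 * (∏ j, Af j) * (W + Real.log (2 * Amax)) := by
              rw [mul_one]; exact mul_le_mul_of_nonneg_right (mul_le_mul_of_nonneg_right hcm hA0) hG2
          _ ≤ c₀ ^ m * q * (∏ j, Af j) * (W + Real.log (2 * Amax)) :=
              mul_le_mul_of_nonneg_right hq2 hG2
          _ ≤ c₀ ^ m * q * (∏ j, Af j) * (W + Real.log ((2 : ℕ) : ℝ) + Real.log (2 * Amax)) := by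
              apply mul_le_mul_of_nonneg_left _ (by positivity)
              rw [hlog2']; linarith only [hlog2]
      linarith only [h, h1, h2]
    · have h := hc₁ p hp hp2 m ξf bf Af Amax W ζ' hζ' (fun j => (hξ' _).1) hAfh hAf1 hAfmax hAmax1 hbW
        hW1 (by rw [hprodf]; exact hΞ1)
      rw [hprodf] at h
      have hcm : c₁ ^ m ≤ c₀ ^ m :=
        le_trans (by rw [← abs_pow]; exact le_abs_self _) (pow_le_pow_left₀ (abs_nonneg _) hc₀₁ m)
      have hXX : 0 ≤ q * (∏ j, Af j) * (W + Real.log p + Real.log (2 * Amax)) := by positivity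
      have := mul_le_mul_of_nonneg_right hcm hXX
      linarith only [h, this]
  -- numerics: `W + log p + log 2A_max ≤ 9^m Y`, `∏Af ≤ Θ/(log 2)^m`
  have hmR : (1 : ℝ) ≤ m := by exact_mod_cast hm1
  have hlogm : Real.log m ≤ (m : ℝ) := by
    have := Real.log_le_sub_one_of_pos (show (0 : ℝ) < m by linarith only [hmR]); linarith only [this]
  have hWle : W ≤ 2 * (m : ℝ) ^ 2 + 1.5 + Y := by
    -- `max(3, X) ≤ 3 m^{2m} M / log 2`
    have hm2m : (1 : ℝ) ≤ (m : ℝ) ^ (2 * m) := one_le_pow₀ hmR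
    have h1 : max 3 X ≤ 3 * (m : ℝ) ^ (2 * m) * M / Real.log 2 := by
      have h2 : logHeight₁ Ξ ≤ M := by
        calc logHeight₁ Ξ = 1 * logHeight₁ Ξ := (one_mul _).symm
          _ ≤ (p : ℝ) * logHeight₁ Ξ := mul_le_mul_of_nonneg_right hp1.le hh0.le
          _ ≤ M := le_max_right _ _
      have h5 : (1 : ℝ) * 1 ≤ (m : ℝ) ^ (2 * m) * M := mul_le_mul hm2m (by linarith) zero_le_one (by positivity)
      have h7 : 0 ≤ (m : ℝ) ^ (2 * m) * M := by positivity
      refine max_le ?_ ?_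
      · rw [le_div_iff₀ hlog2]; linarith only [h5, hl2, h7]
      · rw [hX]
        apply div_le_div_of_nonneg_right _ hlog2.le
        have h6 : (m : ℝ) ^ (2 * m) * logHeight₁ Ξ ≤ (m : ℝ) ^ (2 * m) * M :=
          mul_le_mul_of_nonneg_left h2 (by positivity)
        linarith only [h6, h7]
    have h2 : Real.log (max 3 X) ≤ Real.log (3 * (m : ℝ) ^ (2 * m) * M / Real.log 2) :=
      Real.log_le_log h3X h1
    rw [Real.log_div (by positivity) hlog2.ne', Real.log_mul (by positivity) hM0.ne',
      Real.log_mul (by norm_num) (by positivity), Real.log_pow] at h2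
    have h3 : Real.log 3 ≤ 1.1 := by
      have : (3 : ℝ) ≤ Real.exp 1.1 := by
        have hq := Real.quadratic_le_exp_of_nonneg (show (0 : ℝ) ≤ 0.1 by norm_num)
        have h4 : Real.exp 1.1 = Real.exp 1 * Real.exp 0.1 := by rw [← Real.exp_add]; norm_num
        have h5 := mul_le_mul he1.le hq (by norm_num) hE.le
        rw [h4]; norm_num at h5 ⊢; linarith only [h5]
      have := Real.log_le_log (by norm_num) this; rwa [Real.log_exp] at this
    have h4 : (m : ℝ) * Real.log m ≤ (m : ℝ) * m := mul_le_mul_of_nonneg_left hlogm (by linarith)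
    push_cast at h2
    rw [hW]
    linarith only [h2, h3, h4, hll2, hY]
  have hL2A : Real.log (2 * Amax) ≤ 0.7 + 0.4 * m + Y := by
    rw [hAmax, Real.log_mul two_ne_zero (by positivity), Real.log_div hΘpos.ne' hl2m.ne', Real.log_pow]
    have hmm : (m : ℝ) * (-Real.log (Real.log 2)) ≤ (m : ℝ) * 0.4 :=
      mul_le_mul_of_nonneg_left hll2 (by linarith)
    have hl2c := Real.log_two_lt_d9
    linarith only [hmm, hl2c, hlogΘ]
  have hsum : W + Real.log p + Real.log (2 * Amax) ≤ (9 : ℝ) ^ m * Y := by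
    have h9 := numeric_le_nine_pow m hm1
    have h8 : (2 * (m : ℝ) ^ 2 + m + 3) * 1 ≤ (2 * (m : ℝ) ^ 2 + m + 3) * Y :=
      mul_le_mul_of_nonneg_left hY1 (by positivity)
    calc W + Real.log p + Real.log (2 * Amax) ≤ 2 * (m : ℝ) ^ 2 + 0.4 * m + 2.6 + 3 * Y := by
          linarith only [hWle, hlogp_le, hL2A]
      _ ≤ (2 * (m : ℝ) ^ 2 + m + 6) * Y := by linarith only [h8, hmR, hY1]
      _ ≤ (9 : ℝ) ^ m * Y := mul_le_mul_of_nonneg_right h9 (by linarith)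
  -- assemble
  have h1 : c₀ ^ m * q * (∏ j, Af j) * (W + Real.log p + Real.log (2 * Amax)) ≤
      c₀ ^ m * q * (Θ / Real.log 2 ^ m) * ((9 : ℝ) ^ m * Y) := by
    calc c₀ ^ m * q * (∏ j, Af j) * (W + Real.log p + Real.log (2 * Amax))
        ≤ c₀ ^ m * q * (Θ / Real.log 2 ^ m) * (W + Real.log p + Real.log (2 * Amax)) :=
          mul_le_mul_of_nonneg_right (mul_le_mul_of_nonneg_left hAle (by positivity)) hG0
      _ ≤ c₀ ^ m * q * (Θ / Real.log 2 ^ m) * ((9 : ℝ) ^ m * Y) :=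
          mul_le_mul_of_nonneg_left hsum (by positivity)
  have h2 : c₀ ^ m * q * (Θ / Real.log 2 ^ m) * ((9 : ℝ) ^ m * Y) = K₀ ^ m * q * Y * Θ := by
    rw [hK₀, div_pow, mul_pow]
    field_simp
  have hKK : K₀ ^ m < K ^ m := pow_lt_pow_left₀ (by linarith only [hK₀1, hK]) (by linarith only [hK₀1])
    (by omega)
  have hqYΘ : 0 < q * Y * Θ := by positivity
  have h3 : K₀ ^ m * (q * Y * Θ) < K ^ m * (q * Y * Θ) := mul_lt_mul_of_pos_right hKK hqYΘ
  linarith only [hmain, h1, h2, h3]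

end Summit.ABC.StewartYu

end
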